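import Mathlib
import HarnessLib
import Summits.NavierStokesRegularity.NavierStokesRegularity.Theorems.TaylorModelRungThreeCertificateFormatVGrowth

/-!
# Crux K1b-DR (stmt-NavierStokesRegularity-23954), line `taylor-model` — v3 certificate: the TWO-LEVEL tube-growth checker
# (variant B of `…FormatVGrowth`: sub-blocks of length `ℓ ∣ L` inside each chunk; tm-g4 g4)

Same data layout (`gL1`, `ũ_a`, `T̃_q` in `stageV.landAux`), same tests (`GCtx.pairTest`, `checkL1`, `checkR0`, `checkR1`), same
semantics certified ((R2)/(R3) of `ReadoutsV`); only the in-chunk work changes: interval products are formed only up to the next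
SUB-BLOCK boundary (grid `t/ℓ·ℓ`, `ℓ ∣ L` so chunk boundaries are grid points), and pairs across sub-block boundaries are bounded by
transporting the start vectors through the sub-block magnitude products inside the run (mat-vecs); across chunk boundaries as
before (emitted, verified `ũ`/`T̃`; the chunk product for the `T̃` claim is accumulated from the sub-block products, `L/ℓ − 1`
extra products). Cost per chunk: `L(ℓ−1)/2 + L/ℓ − 1` interval `n³`-products (`L = 25, ℓ = 5`: 54 instead of 300).

* `GState2` — run state: `pre` (prefix products of the current sub-block), `Uin` (transported vectors of this chunk's earlier
  starts, index `a − qL`), `Uout` (transported vectors of earlier chunks' starts, index `a'`), `Pch` (product from the chunk start to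
  the current sub-block start);
* `GCtx.step2 ℓ`, `GCtx.bdry2 ℓ` (sub-block boundary update), `GCtx.claims2`, `growthRun2`, `growthRange2 P j L ℓ q`;
* `vSub`, `vIn`, `vOut`, `gD2`, `Gr2` — the mathematical transported vectors and THE TABLE `G` of this variant; `PchM` (the
  block-bracketed chunk product the run accumulates) and `Inv2` (the run invariant, stated for the soundness file).

Definitions only; soundness in `…FormatVGrowth2Sound`. MODEL-lattice bookkeeping only (rung TL-M3); nothing here is a statement
about the Navier–Stokes equations, and nothing is asserted.
-/

-- the sub-problem namespace repeats the summit name by design (D-0017)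
set_option linter.dupNamespace false

namespace Summit.NavierStokesRegularity.NavierStokesRegularity.Theorems.TaylorModelCert

open scoped BigOperators

/-- Run state of the two-level growth pass. [folklore] -/
structure GState2 where
  /-- prefix products `P(s ← a)` for the starts `a` of the CURRENT sub-block (`a = g, …, s−1`, `g = s/ℓ·ℓ`) -/
  pre : Array (Array (Array IntervalD))
  /-- transported vectors of this chunk's starts before the current sub-block (index `a − qL`) -/
  Uin : Array (Array Dyad)
  /-- transported vectors of the earlier chunks' starts (index `a'`) -/
  Uout : Array (Array Dyad)
  /-- the product from the chunk start to the current sub-block start (identity at the chunk start) -/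
  Pch : Array (Array IntervalD)

namespace GCtx

variable (G : GCtx)

/-- The row vector `(|P|·w)↑`. [folklore] -/
def rowUp (P : Array (Array IntervalD)) (w : Array Dyad) : Array Dyad := absMulVecUp G.n G.prec (magM G.n P) w

/-- ONE sub-step of the two-level pass at sub-step `s` (sub-block start `g = s/ℓ·ℓ`): extend the sub-block prefix products by
`M`, test `0 ≤ L1 ≤ gL1[s]` and every pair `(a', s+1)`: `a'` in the sub-block (direct), `a' = s+1` (identity), `a'` earlier in the
chunk (split at `g` with `Uin`), `a'` in earlier chunks (split at `g` with `Uout`). [folklore] -/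
def step2 (ℓ s : ℕ) (M : Array (Array IntervalD)) (coL1 : Dyad) (st : GState2) : GState2 × Bool :=
  let pre' := (st.pre.map fun P => mulII G.n G.prec M P).push M
  let b := s + 1
  let g := s / ℓ * ℓ
  let okL1 := Dyad.ble Dyad.zero coL1 && Dyad.ble coL1 (dget G.gL1 s)
  let okIn := allN pre'.size fun i => G.pairTest (g + i) b (G.facOf (pre'.getD i #[]) G.ωhi)
  let okDiag := G.pairTest b b (G.facOf (idIM G.n) G.ωhi)
  let okMid := allN (g - G.q * G.L) fun i => G.pairTest (G.q * G.L + i) b (G.facOf (pre'.getD 0 #[]) (st.Uin.getD i #[]))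
  let okOut := allN (G.q * G.L) fun a' => G.pairTest a' b (G.facOf (pre'.getD 0 #[]) (st.Uout.getD a' #[]))
  ({ st with pre := pre' }, okL1 && okIn && okDiag && okMid && okOut)

/-- The SUB-BLOCK BOUNDARY update after sub-step `s` when `s+1` is a grid point: transport all vectors through `|P(s+1 ← g)|`, give the
sub-block's own starts their initial vectors `(|P(s+1 ← a)|·ω↑)↑`, fold the sub-block product into `Pch`, clear `pre`. [folklore] -/
def bdry2 (ℓ s : ℕ) (st : GState2) : GState2 :=
  let g := s / ℓ * ℓ
  let T := magM G.n (st.pre.getD 0 #[])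
  { pre := #[],
    Uin := (st.Uin.map fun u => absMulVecUp G.n G.prec T u) ++
      (Array.ofFn (n := st.pre.size) fun i => G.rowUp (st.pre.getD i #[]) G.ωhi),
    Uout := st.Uout.map fun u => absMulVecUp G.n G.prec T u,
    Pch := if g = G.q * G.L then st.pre.getD 0 #[] else mulII G.n G.prec (st.pre.getD 0 #[]) st.Pch }

/-- The CLAIMS at the chunk end `s` (only if a later chunk exists): `|Pch| ≤ T̃_q` and `Uin[i] ≤ ũ_{qL+i}`. [folklore] -/
def claims2 (s : ℕ) (st : GState2) : Bool :=
  decide (G.S ≤ s) ||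
    (leMatD G.n (magM G.n st.Pch) G.Tq && allN st.Uin.size fun i => leVec G.n (st.Uin.getD i #[]) (G.U (G.q * G.L + i)))

end GCtx

namespace CertTablesV

variable (TV : CertTablesV) (kitOf : ℕ → CoreKit) (wT : ℕ → Array Dyad)

/-- **THE TWO-LEVEL CHUNK RUN**: as `growthRun`, with the sub-block boundary update after every sub-step whose end is a grid point.
[folklore] -/
def growthRun2 (P : ℕ → CoreOut → Bool) (j ℓ : ℕ) (G : GCtx) : ℕ → ℕ → NodeSt → GState2 → Bool
  | 0, s, _, st => G.claims2 s st
  | k + 1, s, N, st =>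
    let o := (TV.ctxOfW kitOf wT j).subStep s N
    let r := G.step2 ℓ s o.core.M o.core.L1 st
    let st' := if (s + 1) % ℓ = 0 then G.bdry2 ℓ s r.1 else r.1
    ((o.ok && P s o.core) && r.2) && growthRun2 P j ℓ G k (s + 1) o.next st'

/-- **TWO-LEVEL GROWTH CHUNK CHECK** of chunk `q` of stage `j` (chunk length `L`, sub-block length `ℓ ∣ L`). [folklore] -/
def growthRange2 (P : ℕ → CoreOut → Bool) (j L ℓ q : ℕ) : Bool :=
  TV.growthRun2 kitOf wT P j ℓ (TV.gctx j L q) (min L (TV.S j - q * L)) (q * L) ((TV.ctxOfW kitOf wT j).startNode (q * L))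
    { pre := #[], Uin := #[], Uout := (TV.gctx j L q).W, Pch := idIM TV.base.n }

/-! ### The mathematical transported vectors and the table of the variant -/

/-- Transport through `m` consecutive sub-blocks starting at the grid point `g`: `|prodM (g+(m−1)ℓ) ℓ|⋯|prodM g ℓ|·w`
(rounded up, one `absMulVecUp` per sub-block). [folklore] -/
def vSub (j ℓ g : ℕ) (w : Array Dyad) : ℕ → Array Dyad
  | 0 => w
  | m + 1 => absMulVecUp TV.base.n TV.prec (magM TV.base.n (TV.prodM kitOf wT j (g + m * ℓ) ℓ)) (vSub j ℓ g w m)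

/-- The start vector of `a` inside its own chunk, at the grid point `(a/ℓ+1)ℓ + mℓ`: initial `(|prodM a ((a/ℓ+1)ℓ − a)|·ω↑)↑`, then
`m` sub-blocks. [folklore] -/
def vIn (j ℓ a m : ℕ) : Array Dyad :=
  TV.vSub kitOf wT j ℓ ((a / ℓ + 1) * ℓ)
    (absMulVecUp TV.base.n TV.prec (magM TV.base.n (TV.prodM kitOf wT j a ((a / ℓ + 1) * ℓ - a))) (TV.ωhiV j)) m

/-- The start vector of `a` in a LATER chunk `q_b`: the emitted chain `T̃_{q_b−1}⋯T̃_{a/L+1}·ũ_a` at `q_b·L`, then `m` sub-blocks of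
chunk `q_b`. [folklore] -/
def vOut (j L ℓ a qb m : ℕ) : Array Dyad :=
  TV.vSub kitOf wT j ℓ (qb * L) (TV.wVec j L a (qb - (a / L + 1))) m

/-- **THE TABLE `G_j(a,b)` OF THE TWO-LEVEL VARIANT** (`a ≤ b ≤ S`): same sub-block — direct product; same chunk — split at the grid
start `g_b` of `b`'s sub-block with `vIn`; later chunk — with `vOut`. [folklore] -/
def gD2 (j L ℓ a b : ℕ) : Dyad :=
  if b ≤ (a / ℓ + 1) * ℓ then (TV.gctx j L (a / L)).facOf (TV.prodM kitOf wT j a (b - a)) (TV.ωhiV j)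
  else
    let gb := (b - 1) / ℓ * ℓ
    let P := TV.prodM kitOf wT j gb (b - gb)
    if b ≤ (a / L + 1) * L then
      (TV.gctx j L (a / L)).facOf P (TV.vIn kitOf wT j ℓ a ((gb - (a / ℓ + 1) * ℓ) / ℓ))
    else
      (TV.gctx j L ((b - 1) / L)).facOf P (TV.vOut kitOf wT j L ℓ a ((b - 1) / L) ((gb - (b - 1) / L * L) / ℓ))

/-- The real table of the variant. [folklore] -/
noncomputable def Gr2 (j L ℓ a b : ℕ) : ℝ := (TV.gD2 kitOf wT j L ℓ a b).toReal

/-- The chunk product as the run accumulates it: BLOCK-bracketed over sub-blocks, `PchM C k = [sub-block k−1]·(⋯([sub-block 0]))`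
(`k = 0`: identity placeholder). [folklore] -/
def PchM (j ℓ C : ℕ) : ℕ → Array (Array IntervalD)
  | 0 => idIM TV.base.n
  | 1 => TV.prodM kitOf wT j C ℓ
  | k + 2 => mulII TV.base.n TV.prec (TV.prodM kitOf wT j (C + (k + 1) * ℓ) ℓ) (PchM j ℓ C (k + 1))

/-- **The run invariant of the two-level pass** at sub-step `s` of chunk `q` (grid start `g = s/ℓ·ℓ`, chunk start `C = qL`): the
state holds exactly the mathematical objects `prodM`, `vIn`, `vOut`, `PchM`. [folklore] -/
def Inv2 (j L ℓ q s : ℕ) (st : GState2) : Prop :=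
  st.pre.size = s - s / ℓ * ℓ ∧
  (∀ i < st.pre.size, st.pre.getD i #[] = TV.prodM kitOf wT j (s / ℓ * ℓ + i) (s - (s / ℓ * ℓ + i))) ∧
  st.Uin.size = s / ℓ * ℓ - q * L ∧
  (∀ i < st.Uin.size, st.Uin.getD i #[] = TV.vIn kitOf wT j ℓ (q * L + i) ((s / ℓ * ℓ - ((q * L + i) / ℓ + 1) * ℓ) / ℓ)) ∧
  st.Uout.size = q * L ∧
  (∀ a' < q * L, st.Uout.getD a' #[] = TV.vOut kitOf wT j L ℓ a' q ((s / ℓ * ℓ - q * L) / ℓ)) ∧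
  (q * L < s / ℓ * ℓ → st.Pch = TV.PchM kitOf wT j ℓ (q * L) ((s / ℓ * ℓ - q * L) / ℓ))

end CertTablesV

end Summit.NavierStokesRegularity.NavierStokesRegularity.Theorems.TaylorModelCert
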